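import Literature.Probability.RandomPlanarGeometry.LoewnerDriverUniformStability
import Literature.Probability.RandomPlanarGeometry.LoewnerSimpleIncrement
import Literature.Probability.RandomPlanarGeometry.LoewnerHullCapacity
import HarnessLib

/-!
# `stub_detMa` — a conformally far gate point, stable under perturbation of the driver
(crux `PathUpgradeR`, stmt-CriticalPhenomena-18055, line `bidir_windows`)

Deterministic Loewner-chain lemma (hypothesis (Ma) of the flank lemma for every driver `U`
sup-norm close to a reference driver `V`). Let `V` be continuous, its chain generated by the
simple curve `γ`. Fix a slab width `θ > 0`, a window length `la ∈ [2θ, 1]` and an oscillation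
bound `ρ₁` of `V` at scale `θ` on `[0, T + 1]`, with `ρ₁ ≤ √la / 200`, `√θ ≤ √la / 400`.

* **The far point for `V` itself** (`PathUpgradeRDetMa.exists_far_incr`): for `t₁ ≤ T` some
  `r ∈ (2θ, la]` has `‖g_{t₁}(γ(t₁ + r)) - V t₁‖ > √la / 13`. Indeed the hull of the shifted
  driver `V(t₁ + ·)` at time `la` is `{g_{t₁}(γ(t₁ + r)) : 0 < r ≤ la}`
  (`hull_shift_eq_image_incrCurve`) and has half-plane capacity `2 la`, so it does not fit in the
  disc of radius `√la / 13` about `V t₁` (`two_mul_le_of_hull_subset_closedBall`: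
  `2 la ≤ 288 la / 169` is absurd); its part of duration `2θ` does fit
  (`hull_subset_closedBall_driving`, Lawler's Lemma 4.13: radius `2ρ₁ + 4√(2θ) ≤ 3√la / 100`).
* **Perturbation** (`stub_detMa`): cover `[0, T]` by the slabs `[kθ, (k + 1)θ]`; for the slab `k`
  the compact set `γ[(k + 2)θ, (k + 1)θ + la]` flows beyond the horizon `(k + 1)θ`, so the
  Kemppainen–Smirnov perturbation lemma (`exists_forall_dist_map_le_of_driving_close`, tolerance
  `√la / 100`) gives `η_k > 0`; `δ₀ := min (min_k η_k) (√la / 100)`. For `U` `δ₀`-close to `V` on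
  `[0, T + 1]` and `t₁` in slab `k`, the `V`-far point `γ(t₁ + r)` lies in the slab's compact set,
  hence still flows beyond `t₁` for `U`, and
  `‖g^U_{t₁}(γ u) - U t₁‖ ≥ √la/13 - √la/100 - √la/100 ≥ √la/40`. [folklore]
-/

noncomputable section

open Set Filter Metric Topology
open scoped NNReal
open UpperHalfPlane (upperHalfPlaneSet)

namespace Summit.CriticalPhenomena.SAWScalingLimit.Theorems

open Literature.Probability.RandomPlanarGeometry Literature.Probability.RandomPlanarGeometry.Loewner

namespace PathUpgradeRDetMa

/-- Numerics of the short initial piece: `2ρ₁ + 4√(2θ) ≤ √la / 13` when `ρ₁ ≤ √la / 200` and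
`√θ ≤ √la / 400`. [folklore] -/
theorem two_mul_add_four_mul_sqrt_le {θ la ρ₁ : ℝ} (hθ : 0 < θ) (hρla : ρ₁ ≤ Real.sqrt la / 200)
    (hθla : Real.sqrt θ ≤ Real.sqrt la / 400) :
    2 * ρ₁ + 4 * Real.sqrt (2 * θ) ≤ Real.sqrt la / 13 := by
  have h2 : Real.sqrt (2 * θ) ≤ 2 * Real.sqrt θ := by
    rw [Real.sqrt_le_iff]
    refine ⟨by positivity, ?_⟩
    nlinarith [Real.sq_sqrt hθ.le]
  nlinarith [Real.sqrt_nonneg la, Real.sqrt_nonneg θ]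

/-- The oscillation of `V` on `[t₁, t₁ + 2θ]` is at most `2ρ₁` when its `θ`-modulus on
`[0, T + 1]` is `ρ₁` (`t₁ ≤ T`, `2θ ≤ 1`). [folklore] -/
theorem abs_sub_le_two_mul_of_modulus {V : ℝ≥0 → ℝ} {T : ℝ≥0} {θ ρ₁ : ℝ} (hθ1 : 2 * θ ≤ 1)
    (hmod : ∀ s s' : ℝ≥0, (s : ℝ) ≤ T + 1 → (s' : ℝ) ≤ T + 1 → |(s : ℝ) - s'| ≤ θ →
      |V s - V s'| ≤ ρ₁)
    {t₁ : ℝ≥0} (ht₁ : (t₁ : ℝ) ≤ T) {s : ℝ≥0} (hs : (s : ℝ) ≤ 2 * θ) :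
    |V (t₁ + s) - V (t₁ + 0)| ≤ 2 * ρ₁ := by
  have hs0 : (0 : ℝ) ≤ s := s.coe_nonneg
  have h1 : |V (t₁ + s) - V (t₁ + s / 2)| ≤ ρ₁ := by
    refine hmod _ _ ?_ ?_ ?_
    · push_cast; linarith
    · push_cast; linarith
    · push_cast
      rw [abs_of_nonneg (by linarith)]
      linarith
  have h2 : |V (t₁ + s / 2) - V (t₁ + 0)| ≤ ρ₁ := by
    refine hmod _ _ ?_ ?_ ?_
    · push_cast; linarith
    · push_cast; linarith
    · push_cast
      rw [abs_of_nonneg (by linarith)]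
      linarith
  calc |V (t₁ + s) - V (t₁ + 0)|
      ≤ |V (t₁ + s) - V (t₁ + s / 2)| + |V (t₁ + s / 2) - V (t₁ + 0)| := abs_sub_le _ _ _
    _ ≤ 2 * ρ₁ := by linarith

/-- **The conformally far point for the reference driver.** For `t₁ ≤ T` there is
`r ∈ (2θ, la]` with `‖g_{t₁}(γ(t₁ + r)) - V t₁‖ > √la / 13`: otherwise the hull of the shifted
driver `V(t₁ + ·)` at time `la` — the set `{g_{t₁}(γ(t₁ + r)) : 0 < r ≤ la}` — would lie in the
disc of radius `√la / 13` about `V t₁` (its part `r ≤ 2θ` by Lawler's Lemma 4.13), contradicting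
`hcap = 2 la`. [folklore] -/
theorem exists_far_incr {V : ℝ≥0 → ℝ} {γ : ℝ≥0 → ℂ} (hV : Continuous V)
    (hγ : IsGeneratedByCurve V γ) (hs : IsSimpleTrace γ) {T : ℝ≥0} {θ la ρ₁ : ℝ} (hθ : 0 < θ)
    (hθla : 2 * θ ≤ la) (hla1 : la ≤ 1) (hρla : ρ₁ ≤ Real.sqrt la / 200)
    (hθla' : Real.sqrt θ ≤ Real.sqrt la / 400)
    (hmod : ∀ s s' : ℝ≥0, (s : ℝ) ≤ T + 1 → (s' : ℝ) ≤ T + 1 → |(s : ℝ) - s'| ≤ θ →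
      |V s - V s'| ≤ ρ₁)
    {t₁ : ℝ≥0} (ht₁ : (t₁ : ℝ) ≤ T) :
    ∃ r : ℝ≥0, 2 * θ < r ∧ (r : ℝ) ≤ la ∧
      Real.sqrt la / 13 < ‖map V t₁ (γ (t₁ + r)) - V t₁‖ := by
  by_contra hcon
  push Not at hcon
  have hla0 : 0 < la := by linarith
  have hV₁ : Continuous fun r : ℝ≥0 ↦ V (t₁ + r) := hV.comp (continuous_const.add continuous_id)
  set L : ℝ≥0 := ⟨la, hla0.le⟩ with hL
  set Θ : ℝ≥0 := ⟨2 * θ, by positivity⟩ with hΘ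
  have hnum := two_mul_add_four_mul_sqrt_le hθ hρla hθla'
  -- the whole hull of duration `la` fits in the small disc
  have hsub : hull (fun r : ℝ≥0 ↦ V (t₁ + r)) L ⊆ closedBall ((V t₁ : ℝ) : ℂ) (Real.sqrt la / 13) := by
    intro w hw
    rw [hull_shift_eq_image_incrCurve hγ hs hV t₁ L] at hw
    obtain ⟨r, ⟨hr0, hrL⟩, rfl⟩ := hw
    by_cases hr : 2 * θ < r
    · rw [incrCurve_of_pos V γ t₁ hr0]
      exact mem_closedBall_iff_norm.2 (hcon r hr hrL)
    · rw [not_lt] at hr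
      have hrΘ : r ≤ Θ := NNReal.coe_le_coe.1 hr
      have hmem : incrCurve V γ t₁ r ∈ hull (fun r : ℝ≥0 ↦ V (t₁ + r)) Θ :=
        hull_mono _ hrΘ (incrCurve_mem_hull hγ hs hV t₁ hr0)
      have hosc : ∀ s : ℝ≥0, s ≤ Θ → |V (t₁ + s) - V (t₁ + 0)| ≤ 2 * ρ₁ := fun s hs' ↦
        abs_sub_le_two_mul_of_modulus (by linarith) hmod ht₁ (NNReal.coe_le_coe.2 hs')
      have hball := hull_subset_closedBall_driving hV₁ hosc hmem
      rw [add_zero] at hball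
      exact closedBall_subset_closedBall (le_trans (by rfl) hnum) hball
  have h2 := two_mul_le_of_hull_subset_closedBall hV₁ (by positivity) hsub
  have hsq : (Real.sqrt la / 13) ^ 2 = la / 169 := by
    rw [div_pow, Real.sq_sqrt hla0.le]; norm_num
  rw [hsq] at h2
  have hLv : ((L : ℝ≥0) : ℝ) = la := rfl
  rw [hLv] at h2
  linarith

end PathUpgradeRDetMa

open PathUpgradeRDetMa in
/-- **(Ma) for every driver close to the reference.** For the reference pair `(V, γ)` (continuous
driver, simple generating curve) and slab/window/oscillation constants as in the flank lemma, there
is `δ₀ > 0` such that for every continuous `U` that is `δ₀`-close to `V` on `[0, T + 1]` and every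
`t₁ ≤ T`, some `u ∈ [t₁ + 2θ, t₁ + la]` has `γ u` still flowing at time `t₁` for `U` and
`‖g^U_{t₁}(γ u) - U t₁‖ ≥ √la / 40` (far point of the reference chain by half-plane capacity,
transported by the Kemppainen–Smirnov perturbation lemma on finitely many time slabs). [folklore] -/
theorem stub_detMa : ∀ (V : NNReal → ℝ) (γ : NNReal → ℂ), Continuous V → Literature.Probability.RandomPlanarGeometry.Loewner.IsGeneratedByCurve V γ → Literature.Probability.RandomPlanarGeometry.Loewner.IsSimpleTrace γ → (∀ t : NNReal, 0 < t → closure (Literature.Probability.RandomPlanarGeometry.Loewner.hull V t) = γ '' Set.Icc 0 t) → ∀ (T : NNReal) (θ la ρ₁ : ℝ), 0 < θ → 2 * θ ≤ la → la ≤ 1 → 0 ≤ ρ₁ → ρ₁ ≤ Real.sqrt la / 200 → Real.sqrt θ ≤ Real.sqrt la / 400 → (∀ s s' : NNReal, (s : ℝ) ≤ T + 1 → (s' : ℝ) ≤ T + 1 → |(s : ℝ) - s'| ≤ θ → |V s - V s'| ≤ ρ₁) → ∃ δ₀ : ℝ, 0 < δ₀ ∧ ∀ U : NNReal → ℝ,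 Continuous U → (∀ s : NNReal, (s : ℝ) ≤ T + 1 → |U s - V s| ≤ δ₀) → ∀ t₁ : NNReal, (t₁ : ℝ) ≤ T → ∃ u : NNReal, (t₁ : ℝ) + 2 * θ ≤ u ∧ (u : ℝ) ≤ t₁ + la ∧ γ u ∈ Literature.Probability.RandomPlanarGeometry.Loewner.domain U t₁ ∧ Real.sqrt la / 40 ≤ ‖Literature.Probability.RandomPlanarGeometry.Loewner.map U t₁ (γ u) - U t₁‖ := by
  intro V γ hV hγ hs _hcl T θ la ρ₁ hθ hθla hla1 _hρ₁ hρla hθla' hmod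
  have hla0 : 0 < la := by linarith
  have hε : 0 < Real.sqrt la / 100 := by positivity
  -- Kemppainen–Smirnov on each slab
  have hdata : ∀ k : ℕ, ∃ η > (0 : ℝ), ∀ U : ℝ≥0 → ℝ, Continuous U →
      (∀ s : ℝ≥0, s ≤ (((k : ℝ) + 1) * θ).toNNReal → |V s - U s| ≤ η) →
      ∀ z ∈ γ '' Icc ((((k : ℝ) + 2) * θ).toNNReal) ((((k : ℝ) + 1) * θ + la).toNNReal),
        (((((k : ℝ) + 1) * θ).toNNReal : ℝ≥0) : WithTop ℝ≥0) < swallowingTime U z ∧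
        ∀ s : ℝ≥0, s ≤ (((k : ℝ) + 1) * θ).toNNReal →
          dist (map U s z) (map V s z) ≤ Real.sqrt la / 100 := by
    intro k
    refine exists_forall_dist_map_le_of_driving_close hV (isCompact_Icc.image hγ.continuous)
      ?_ hε
    rintro z ⟨u, ⟨hu1, -⟩, rfl⟩
    have hlt : (((k : ℝ) + 1) * θ).toNNReal < u := by
      refine lt_of_lt_of_le ((Real.toNNReal_lt_toNNReal_iff (by positivity)).2 ?_) hu1
      nlinarith
    exact ((mem_domain_iff V _ _).1 (hγ.apply_mem_domain_of_lt hs hlt)).2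
  choose η hη hKS using hdata
  set N : ℕ := ⌊(T : ℝ) / θ⌋₊ with hN
  have hne : (Finset.range (N + 1)).Nonempty := ⟨0, by simp⟩
  set η₀ : ℝ := (Finset.range (N + 1)).inf' hne η with hη₀
  have hη₀pos : 0 < η₀ := (Finset.lt_inf'_iff hne).2 fun k _ ↦ hη k
  refine ⟨min η₀ (Real.sqrt la / 100), lt_min hη₀pos hε, ?_⟩
  intro U hU hUV t₁ ht₁
  -- the slab of `t₁`
  set k : ℕ := ⌊(t₁ : ℝ) / θ⌋₊ with hk
  have hk1 : (k : ℝ) * θ ≤ t₁ := by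
    have := Nat.floor_le (div_nonneg t₁.coe_nonneg hθ.le)
    rwa [← hk, le_div_iff₀ hθ] at this
  have hk2 : (t₁ : ℝ) < ((k : ℝ) + 1) * θ := by
    have := Nat.lt_floor_add_one ((t₁ : ℝ) / θ)
    rwa [← hk, div_lt_iff₀ hθ] at this
  have hkN : k ∈ Finset.range (N + 1) := by
    rw [Finset.mem_range, Nat.lt_succ_iff, hk, hN]
    exact Nat.floor_mono (div_le_div_of_nonneg_right ht₁ hθ.le)
  have hηk : min η₀ (Real.sqrt la / 100) ≤ η k :=
    (min_le_left _ _).trans (Finset.inf'_le η hkN)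
  have hbT : ((k : ℝ) + 1) * θ ≤ T + 1 := by nlinarith
  have hclose : ∀ s : ℝ≥0, s ≤ (((k : ℝ) + 1) * θ).toNNReal → |V s - U s| ≤ η k := by
    intro s hs'
    rw [abs_sub_comm]
    refine (hUV s ?_).trans hηk
    have h := Real.toNNReal_le_iff_le_coe.1 (le_of_eq rfl : (((k : ℝ) + 1) * θ).toNNReal ≤ _)
    have : (s : ℝ) ≤ ((k : ℝ) + 1) * θ := by
      have := NNReal.coe_le_coe.2 hs'
      rwa [Real.coe_toNNReal _ (by positivity)] at this
    linarith
  -- the far point of the reference chain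
  obtain ⟨r, hr1, hr2, hr3⟩ := exists_far_incr hV hγ hs hθ hθla hla1 hρla hθla' hmod ht₁
  have hz : γ (t₁ + r) ∈
      γ '' Icc ((((k : ℝ) + 2) * θ).toNNReal) ((((k : ℝ) + 1) * θ + la).toNNReal) := by
    refine ⟨t₁ + r, ⟨?_, ?_⟩, rfl⟩
    · rw [Real.toNNReal_le_iff_le_coe]
      push_cast
      linarith
    · rw [Real.le_toNNReal_iff_coe_le (by positivity)]
      push_cast
      linarith
  obtain ⟨hsw, hdist⟩ := hKS k U hU hclose _ hz
  have ht₁b : t₁ ≤ (((k : ℝ) + 1) * θ).toNNReal := by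
    rw [Real.le_toNNReal_iff_coe_le (by positivity)]
    exact hk2.le
  refine ⟨t₁ + r, ?_, ?_, ?_, ?_⟩
  · push_cast; linarith
  · push_cast; linarith
  · rw [mem_domain_iff]
    refine ⟨hs.2 _ (lt_of_le_of_lt bot_le (lt_add_of_pos_right t₁ ?_)), ?_⟩
    · exact lt_of_le_of_lt bot_le (show ((⟨2 * θ, by positivity⟩ : ℝ≥0)) < r from hr1)
    · exact lt_of_le_of_lt (WithTop.coe_le_coe.2 ht₁b) hsw
  · have h2 := hdist t₁ ht₁b
    have h3 : |U t₁ - V t₁| ≤ Real.sqrt la / 100 :=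
      (hUV t₁ (by linarith)).trans (min_le_right _ _)
    have h3' : ‖((U t₁ : ℝ) : ℂ) - ((V t₁ : ℝ) : ℂ)‖ ≤ Real.sqrt la / 100 := by
      rw [← Complex.ofReal_sub, Complex.norm_real, Real.norm_eq_abs]; exact h3
    rw [dist_comm, dist_eq_norm] at h2
    have htri : ‖map V t₁ (γ (t₁ + r)) - V t₁‖ ≤
        ‖map V t₁ (γ (t₁ + r)) - map U t₁ (γ (t₁ + r))‖ +
          ‖map U t₁ (γ (t₁ + r)) - U t₁‖ + ‖((U t₁ : ℝ) : ℂ) - ((V t₁ : ℝ) : ℂ)‖ :=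
      calc ‖map V t₁ (γ (t₁ + r)) - V t₁‖
          ≤ ‖map V t₁ (γ (t₁ + r)) - U t₁‖ + ‖((U t₁ : ℝ) : ℂ) - ((V t₁ : ℝ) : ℂ)‖ :=
            norm_sub_le_norm_sub_add_norm_sub _ _ _
        _ ≤ _ := by
            gcongr
            exact norm_sub_le_norm_sub_add_norm_sub _ _ _
    nlinarith [Real.sqrt_nonneg la]

end Summit.CriticalPhenomena.SAWScalingLimit.Theorems

end
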